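import Summits.BirchSwinnertonDyer.BirchSwinnertonDyer.Theorems.AlignedTransportAtTwoMainConjectureOfRankZeroBSDAtTwoHalfDescentLayerIndexFinite
import HarnessLib

/-!
# Route `AlignedTransportAtTwo`, crux C2 `MainConjectureOfRankZeroBSDAtTwo` (stmt-BirchSwinnertonDyer-22298):
# THE DESCENT NUMBER WITHOUT GREENBERG 4.14, III — THE HYPOTHESIS-FREE CERTIFICATE: for EVERY finitely generated torsion `Λ`-module `X` with
# `char_Λ X = (f)` and EVERY Eisenstein distinguished `g`: `p^{deg g·μ(f)} ∣ #(X/gX)` (`Nat.card`; `g ∣ f ⟹ X/gX` is infinite), hence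
# `0 < #(X/Ψ_n X) < p^{pⁿ(p−1)}` at ANY ONE layer `n` ⟹ `μ(X) = 0` — no `λ`-bookkeeping, no finite-submodule hypothesis, no exact count

HONEST FRAMING (cell `bsd-f1-sign2`, WIDTH-5 attached prover seat `bsd-line-att-p5` gen 55 on line `birth` of the lead `bsd-line-att-p2`;
`--supports` stmt-BirchSwinnertonDyer-22298, closes nothing; BSD is NOT proved by any of this; the crux C2, its verdict «blocked-on
`Rank1Residual.GreenbergMuConjectureIrreducible`» and every registered stub (P / T / Kμ / LimDoor / MuIneqʳ / PFμ⁺) are untouched). THEOREMS ONLY —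
pure commutative algebra over `Λ = ℤ_p⟦T⟧`, any prime `p`; no `def`, no instance, no named fact, no `sorry`. Sequel of `…HalfDescentLayerIndexFinite` (this gen:
`#(X/gX) = p^{deg g·μ+λ}·#(F/gF)` and `#(X/gX) < p^{deg g} ⟹ μ = 0`, both under `λ(f) < deg g`). THIS FILE removes the hypothesis `λ(f) < deg g`: what it
bought was `g ∤ f`, and `g ∤ f` is DETECTED by the index itself (`g ∣ f` makes `X/gX` infinite), so the certificate becomes checkable with no knowledge of `λ`.

THE POINT.
* §1 (`X` WITHOUT non-zero finite submodule, square presentation `Λⁿ —P→ Λⁿ ↠ X`, `(f) = (det P)`, `X/gX ≅ 𝒪ⁿ/P̄ᵀ𝒪ⁿ` over the DVR `𝒪 = Λ/(g)` — g54's frame)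
  ★ `natCard_quotient_smul_top_eq_natCard_quotient_span_sup`: `g ∤ f` ⟹ **`#(X/gX) = #Λ/(f, g)`** (THE MODULE INDEX IS THE CYCLIC INDEX: Fulton's
  `length(𝒪ⁿ/P̄ᵀ𝒪ⁿ) = length(𝒪/det P̄)` and `#N = p^{length N}`); ★ `not_dvd_of_natCard_quotient_smul_top_ne_zero`: **`X/gX` finite ⟹ `g ∤ f`** (a finite
  cokernel `𝒪ⁿ/Q𝒪ⁿ` of order `c` gives `Q·W = c·1`, so `det Q · det W = cⁿ ≠ 0` in the characteristic-zero domain `𝒪`, while `g ∣ f` means `det Q = f̄ = 0`).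
* §2 (cyclic) ★ `natCard_quotient_span_sup_span_coe_eq_pow_mul`: **`#Λ/(F, g) = p^{deg g·μ(F)} · #Λ/(F₀, g)`**, `F = p^{μ(F)}·F₀` the `p`-content split — for
  EVERY `F` (multiplicativity in the domain `𝒪`, `#Λ/(g, p^k) = p^{k·deg g}`); hence `p^{deg g·μ(F)} ∣ #Λ/(F, g)`.
* §3 (ANY f.g. torsion `X`, `char_Λ X = (f)`, largest finite submodule `F`) ★★ `natCard_quotient_smul_top_eq_zero_of_dvd` (`g ∣ f ⟹ #(X/gX) = 0`, i.e. infinite);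
  ★★ `natCard_quotient_smul_top_eq_mul_of_not_dvd` (`g ∤ f ⟹ #(X/gX) = #Λ/(f, g)·#(F/gF)`); ★★★ **`pow_dvd_natCard_quotient_smul_top'`: `p^{deg g·μ(f)} ∣ #(X/gX)`
  UNCONDITIONALLY**; ★★★ **`mu_eq_zero_of_natCard_quotient_smul_top_pos_lt`: `0 < #(X/gX) < p^{deg g} ⟹ μ(f) = 0`**; layer forms
  ★★★ **`mu_eq_zero_of_natCard_layerQuotient_pos_lt` / `muInvariant_eq_zero_of_natCard_layerQuotient_pos_lt`: `0 < #(X/Ψ_n X) < p^{pⁿ(p−1)}` at ANY ONE `n`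
  ⟹ `μ(X) = 0`**.
Reading for C2: the `μ`-residue of the seed is certified by ONE inequality on ONE layer quotient (in Selmer currency ONE relative-norm kernel, sequel
`…HalfDescentLayerIndexCertificateSelmer`, which composes with the seed `…Seed.mazurMainConjecture_two_of_bsdp_of_mu_eq_zero`): no `λ_an`, no `G`, no Kato needed
for the `μ`-statement itself. Memo `Cruxes/MainConjectureOfRankZeroBSDAtTwo/LAYER-INDEX-FINITE-att-p5-g55.md`. BSD is not proved by any of this; nothing about any curve
is asserted here.

References: W. Fulton, *Intersection Theory*, Lemma A.2.6 [Fulton1998]; The Stacks Project, Tags 07Z6, 02MI [StacksProject]; L. Washington, GTM 83, §7.1, §13.2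
(Lemma 13.7, Prop. 13.8), §13.3 (Thm. 13.13) [Washington1997]; J. Neukirch, A. Schmidt, K. Wingberg, (5.3.1), (5.3.17) [NeukirchSchmidtWingberg2008]; R. Greenberg,
LNM 1716 (1999), Conj. 1.11, §4 p. 117 [GreenbergLNM1716].
-/

set_option linter.dupNamespace false
set_option autoImplicit false

noncomputable section

open scoped Classical Polynomial

namespace Summit.BirchSwinnertonDyer.BirchSwinnertonDyer.Theorems.AlignedTransportAtTwoHalfDescentLayerIndexCertificate

open Literature.NumberTheory.EllipticCurves Literature.NumberTheory.EllipticCurves.IwasawaAlgebra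
  Literature.RingTheory.FittingIdeal Literature.RingTheory.OrderOfVanishing
  Summit.BirchSwinnertonDyer.Rank1Residual.X1.MuLambda
  Summit.BirchSwinnertonDyer.Rank1Residual.X1.ParitySqueeze
  Summit.BirchSwinnertonDyer.Rank1Residual.X1.GeneratorBoundOrd
  Summit.BirchSwinnertonDyer.Rank1Residual.X1.GeneratorBoundMu
  Summit.BirchSwinnertonDyer.Rank1Residual.Iwasawa
  Summit.BirchSwinnertonDyer.BirchSwinnertonDyer.Theorems.DefectPrime
  Summit.BirchSwinnertonDyer.BirchSwinnertonDyer.Theorems.AlignedTransportAtTwoCyclotomicLayerPrime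
  Summit.BirchSwinnertonDyer.BirchSwinnertonDyer.Theorems.AlignedTransportAtTwoHalfDescentLayerRing
  Summit.BirchSwinnertonDyer.BirchSwinnertonDyer.Theorems.AlignedTransportAtTwoHalfDescentLayerIndex
  Summit.BirchSwinnertonDyer.BirchSwinnertonDyer.Theorems.AlignedTransportAtTwoHalfDescentLayerIndexModule
  Summit.BirchSwinnertonDyer.BirchSwinnertonDyer.Theorems.AlignedTransportAtTwoHalfDescentLayerIndexTower
  Summit.BirchSwinnertonDyer.BirchSwinnertonDyer.Theorems.AlignedTransportAtTwoHalfDescentLayerIndexFinite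

universe u

variable {p : ℕ} [hp : Fact p.Prime] {M : Type u} [AddCommGroup M] [Module (IwasawaAlgebra p) M] {g : ℤ_[p][X]}

/-! ## §1 No finite submodule: the module index is the cyclic index; a finite layer quotient forces `g ∤ f` -/

section NoFinite

/-- (frame, g54) A square presentation of `X` reduced modulo `g`: there is a square matrix `Q` over `𝒪 = Λ/(g)` with `(det Q) = (f mod g)` and
`#(X/gX) = #(𝒪ⁿ/Q𝒪ⁿ)` (`X` f.g. torsion without finite submodule, `char_Λ X = (f)`: `pd_Λ X ≤ 1`, `char = Fitt₀ = (det P)`). [cite: StacksProject, Tag 07Z6] -/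
private theorem exists_square_presentation_mod [Module.Finite (IwasawaAlgebra p) M] (hM : Module.IsTorsion (IwasawaAlgebra p) M)
    (hnf : ∀ N : Submodule (IwasawaAlgebra p) M, Finite N → N = ⊥) {f : IwasawaAlgebra p}
    (hchar : Literature.NumberTheory.EllipticCurves.Module.charIdeal (IwasawaAlgebra p) M = Ideal.span {f}) :
    ∃ (n : ℕ) (Q : Matrix (Fin n) (Fin n) (IwasawaAlgebra p ⧸ Ideal.span {(g : IwasawaAlgebra p)})),
      Ideal.span {Q.det} = Ideal.span {Ideal.Quotient.mk (Ideal.span {(g : IwasawaAlgebra p)}) f} ∧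
      Nat.card (M ⧸ (Ideal.span {(g : IwasawaAlgebra p)} • ⊤ : Submodule (IwasawaAlgebra p) M)) =
        Nat.card ((Fin n → IwasawaAlgebra p ⧸ Ideal.span {(g : IwasawaAlgebra p)}) ⧸ LinearMap.range (Matrix.toLin' Q)) := by
  classical
  obtain ⟨n, x, hx⟩ := Module.Finite.exists_fin (R := IwasawaAlgebra p) (M := M)
  let π : (Fin n → IwasawaAlgebra p) →ₗ[IwasawaAlgebra p] M := Fintype.linearCombination _ x
  have hπ : ∀ c, π c = ∑ i, c i • x i := fun c ↦ Fintype.linearCombination_apply _ _ c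
  have hsurj : Function.Surjective π := by
    rw [← LinearMap.range_eq_top, eq_top_iff, ← hx, Submodule.span_le]
    rintro _ ⟨i, rfl⟩
    refine ⟨Pi.single i 1, ?_⟩
    rw [hπ, Finset.sum_eq_single i (fun j _ hj ↦ by rw [Pi.single_eq_of_ne hj, zero_smul]) (fun hi ↦ absurd (Finset.mem_univ i) hi),
      Pi.single_eq_same, one_smul]
  haveI := free_ker π hnf
  let b : Module.Basis (Fin n) (IwasawaAlgebra p) (LinearMap.ker π) := Module.finBasisOfFinrankEq _ _ (finrank_ker_eq π hsurj hM)
  let P : Matrix (Fin n) (Fin n) (IwasawaAlgebra p) := Matrix.of fun t l ↦ ((b t : LinearMap.ker π) : Fin n → IwasawaAlgebra p) l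
  have hP : ∀ t, ∑ l, P t l • x l = 0 := fun t ↦ by
    have h2 := (b t).2
    rw [LinearMap.mem_ker, hπ] at h2
    simpa [P] using h2
  have hK : LinearMap.ker π = Submodule.span (IwasawaAlgebra p) (Set.range P) := by
    have e : Set.range P = (LinearMap.ker π).subtype '' Set.range b := by rw [← Set.range_comp]; rfl
    rw [e, Submodule.span_image, b.span_eq, Submodule.map_subtype_top]
  have hgen : ∀ ρ : Fin n → IwasawaAlgebra p, ∑ l, ρ l • x l = 0 → ρ ∈ Submodule.span (IwasawaAlgebra p) (Set.range P) := fun ρ hρ ↦ by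
    rw [← hK, LinearMap.mem_ker, hπ]; exact hρ
  have hspan : Ideal.span {f} = Ideal.span {P.det} := by
    rw [← hchar, charIdeal_eq_fittingIdeal_zero hM hnf, Module.fittingIdeal_zero_eq_span_det_of_square_presentation x hx P hP hgen]
  refine ⟨n, P.transpose.map (Ideal.Quotient.mk (Ideal.span {(g : IwasawaAlgebra p)})), ?_,
    natCard_quotient_smul_top_eq_of_presentation π hsurj P hK (Ideal.span {(g : IwasawaAlgebra p)})⟩
  have hQdet : (P.transpose.map (Ideal.Quotient.mk (Ideal.span {(g : IwasawaAlgebra p)}))).det =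
      Ideal.Quotient.mk (Ideal.span {(g : IwasawaAlgebra p)}) P.det := by
    rw [← RingHom.mapMatrix_apply, ← RingHom.map_det, Matrix.det_transpose]
  have h := congrArg (Ideal.map (Ideal.Quotient.mk (Ideal.span {(g : IwasawaAlgebra p)}))) hspan
  rw [Ideal.map_span, Ideal.map_span, Set.image_singleton, Set.image_singleton] at h
  rw [hQdet, h]

/-- An Eisenstein distinguished `g` which is prime in `Λ` has `deg g ≥ 1` (a distinguished polynomial of degree `0` is `1`). [folklore] -/
theorem one_le_natDegree_of_prime (hg : g.IsDistinguishedAt (IsLocalRing.maximalIdeal ℤ_[p])) (hgp : Prime (g : IwasawaAlgebra p)) :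
    1 ≤ g.natDegree := by
  by_contra h
  have h0 : g.natDegree = 0 := by omega
  have h1 : g = 1 := Polynomial.eq_one_of_monic_natDegree_zero hg.monic h0
  exact hgp.not_unit (by rw [h1, Polynomial.coe_one]; exact isUnit_one)

/-- ★ **THE MODULE INDEX IS THE CYCLIC INDEX.** `X` f.g. torsion over `Λ` WITHOUT non-zero finite submodule, `char_Λ X = (f)`, `g` Eisenstein distinguished
(`g(0) = p`, prime in `Λ`) with `g ∤ f`. Then **`#(X/gX) = #Λ/(f, g)`** — whatever `λ(f)` is (Fulton: `length_𝒪(𝒪ⁿ/P̄ᵀ𝒪ⁿ) = length_𝒪(𝒪/(f̄))` over the DVR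
`𝒪 = Λ/(g)`, and both orders are `p^{length}`). [cite: Fulton1998, Lemma A.2.6] [cite: StacksProject, Tag 02MI] [cite: Washington1997, §13.3] -/
theorem natCard_quotient_smul_top_eq_natCard_quotient_span_sup (hg0 : PowerSeries.constantCoeff (g : IwasawaAlgebra p) = p)
    (hgp : Prime (g : IwasawaAlgebra p)) [Module.Finite (IwasawaAlgebra p) M] (hM : Module.IsTorsion (IwasawaAlgebra p) M)
    (hnf : ∀ N : Submodule (IwasawaAlgebra p) M, Finite N → N = ⊥) {f : IwasawaAlgebra p}
    (hchar : Literature.NumberTheory.EllipticCurves.Module.charIdeal (IwasawaAlgebra p) M = Ideal.span {f}) (hgf : ¬ (g : IwasawaAlgebra p) ∣ f) :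
    Nat.card (M ⧸ (Ideal.span {(g : IwasawaAlgebra p)} • ⊤ : Submodule (IwasawaAlgebra p) M)) =
      Nat.card (IwasawaAlgebra p ⧸ (Ideal.span {f} ⊔ Ideal.span {(g : IwasawaAlgebra p)})) := by
  letI hdom := isDomain_quotient hgp
  letI hdvr := isDiscreteValuationRing_quotient hg0 hgp
  obtain ⟨n, Q, hspanQ, hcard⟩ := exists_square_presentation_mod (g := g) hM hnf hchar
  have hQdet0 : Q.det ≠ 0 := by
    intro h0
    have hmem : Ideal.Quotient.mk (Ideal.span {(g : IwasawaAlgebra p)}) f ∈ Ideal.span {Q.det} := by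
      rw [hspanQ]; exact Ideal.mem_span_singleton_self _
    rw [h0, Ideal.span_singleton_zero, Ideal.mem_bot, Ideal.Quotient.eq_zero_iff_mem, Ideal.mem_span_singleton] at hmem
    exact hgf hmem
  -- Fulton A.2.6
  have hlen := length_quotient_range_toLin'_eq_ord_det Q hQdet0
  rw [Ring.ord] at hlen
  -- the cyclic side is finite: `#𝒪/(f̄) = #Λ/(f, g) = p^v`
  obtain ⟨v, hv⟩ := exists_natCard_quotient_span_sup_span_coe_eq_pow hg0 hgp hgf
  have hfin2 : Finite ((IwasawaAlgebra p ⧸ Ideal.span {(g : IwasawaAlgebra p)}) ⧸ Ideal.span {Q.det}) := by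
    apply Nat.finite_of_card_ne_zero
    rw [Nat.card_congr (Submodule.quotEquivOfEq _ _ hspanQ).toEquiv, natCard_quotient_span_mk_eq_natCard_quotient_sup, hv]
    exact pow_ne_zero _ hp.out.ne_zero
  have hlen2 : Module.length (IwasawaAlgebra p ⧸ Ideal.span {(g : IwasawaAlgebra p)})
      ((IwasawaAlgebra p ⧸ Ideal.span {(g : IwasawaAlgebra p)}) ⧸ Ideal.span {Q.det}) ≠ ⊤ :=
    Module.length_ne_top_iff.mpr Module.isFiniteLength_of_finite
  have hfl : IsFiniteLength (IwasawaAlgebra p ⧸ Ideal.span {(g : IwasawaAlgebra p)})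
      ((Fin n → IwasawaAlgebra p ⧸ Ideal.span {(g : IwasawaAlgebra p)}) ⧸ LinearMap.range (Matrix.toLin' Q)) := by
    rw [← Module.length_ne_top_iff, hlen]
    exact hlen2
  rw [hcard, natCard_eq_pow_length_quotient hg0 hgp hfl, hlen, ← natCard_eq_pow_length_quotient_of_finite hg0 hgp,
    Nat.card_congr (Submodule.quotEquivOfEq _ _ hspanQ).toEquiv, natCard_quotient_span_mk_eq_natCard_quotient_sup]

/-- ★ **A FINITE LAYER QUOTIENT FORCES `g ∤ f`.** `X` f.g. torsion WITHOUT non-zero finite submodule, `char_Λ X = (f)`, `g` Eisenstein distinguished; if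
`#(X/gX) ≠ 0` (i.e. `X/gX` is finite) then **`g ∤ f`**. Proof: `X/gX ≅ 𝒪ⁿ/Q𝒪ⁿ` finite of order `c` ⟹ `c·eᵢ ∈ Q𝒪ⁿ`, so `Q·W = c·1` and
`det Q·det W = cⁿ ≠ 0` (`𝒪 ⊇ ℤ_p` has characteristic `0`: `g ∤ c`), whereas `g ∣ f` is `det Q = f̄ = 0`. [cite: StacksProject, Tag 07Z6] [cite: Washington1997, §13.2] -/
theorem not_dvd_of_natCard_quotient_smul_top_ne_zero (hg : g.IsDistinguishedAt (IsLocalRing.maximalIdeal ℤ_[p]))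
    (hgp : Prime (g : IwasawaAlgebra p)) [Module.Finite (IwasawaAlgebra p) M] (hM : Module.IsTorsion (IwasawaAlgebra p) M)
    (hnf : ∀ N : Submodule (IwasawaAlgebra p) M, Finite N → N = ⊥) {f : IwasawaAlgebra p}
    (hchar : Literature.NumberTheory.EllipticCurves.Module.charIdeal (IwasawaAlgebra p) M = Ideal.span {f})
    (hne : Nat.card (M ⧸ (Ideal.span {(g : IwasawaAlgebra p)} • ⊤ : Submodule (IwasawaAlgebra p) M)) ≠ 0) : ¬ (g : IwasawaAlgebra p) ∣ f := by
  letI hdom := isDomain_quotient hgp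
  obtain ⟨n, Q, hspanQ, hcard⟩ := exists_square_presentation_mod (g := g) hM hnf hchar
  rw [hcard] at hne
  haveI : Finite ((Fin n → IwasawaAlgebra p ⧸ Ideal.span {(g : IwasawaAlgebra p)}) ⧸ LinearMap.range (Matrix.toLin' Q)) :=
    Nat.finite_of_card_ne_zero hne
  -- `c · eᵢ ∈ Q𝒪ⁿ`, `c` the order of the cokernel
  have hmem : ∀ i : Fin n,
      ((Nat.card ((Fin n → IwasawaAlgebra p ⧸ Ideal.span {(g : IwasawaAlgebra p)}) ⧸ LinearMap.range (Matrix.toLin' Q)) :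
          IwasawaAlgebra p ⧸ Ideal.span {(g : IwasawaAlgebra p)}) • Pi.single i (1 : IwasawaAlgebra p ⧸ Ideal.span {(g : IwasawaAlgebra p)}) :
        Fin n → IwasawaAlgebra p ⧸ Ideal.span {(g : IwasawaAlgebra p)}) ∈ LinearMap.range (Matrix.toLin' Q) := fun i ↦ by
    rw [← Submodule.Quotient.mk_eq_zero, Submodule.Quotient.mk_smul, Nat.cast_smul_eq_nsmul]
    exact card_nsmul_eq_zero'
  choose w hw using fun i ↦ LinearMap.mem_range.mp (hmem i)
  have hQW : Q * (Matrix.of fun j i ↦ w i j) =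
      ((Nat.card ((Fin n → IwasawaAlgebra p ⧸ Ideal.span {(g : IwasawaAlgebra p)}) ⧸ LinearMap.range (Matrix.toLin' Q)) :
          IwasawaAlgebra p ⧸ Ideal.span {(g : IwasawaAlgebra p)})) • (1 : Matrix (Fin n) (Fin n) (IwasawaAlgebra p ⧸ Ideal.span {(g : IwasawaAlgebra p)})) := by
    ext j i
    have h := congrFun (hw i) j
    rw [Matrix.toLin'_apply] at h
    rw [Matrix.mul_apply, Matrix.smul_apply, Matrix.one_apply, smul_eq_mul]
    have e : ∑ k, Q j k * (Matrix.of fun j i ↦ w i j) k i = Q.mulVec (w i) j := rfl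
    rw [e, h, Pi.smul_apply, Pi.single_apply, smul_eq_mul]
  have hdet : Q.det * (Matrix.of fun j i ↦ w i j).det =
      ((Nat.card ((Fin n → IwasawaAlgebra p ⧸ Ideal.span {(g : IwasawaAlgebra p)}) ⧸ LinearMap.range (Matrix.toLin' Q)) :
          IwasawaAlgebra p ⧸ Ideal.span {(g : IwasawaAlgebra p)})) ^ n := by
    rw [← Matrix.det_mul, hQW, Matrix.det_smul, Matrix.det_one, mul_one, Fintype.card_fin]
  set c : ℕ := Nat.card ((Fin n → IwasawaAlgebra p ⧸ Ideal.span {(g : IwasawaAlgebra p)}) ⧸ LinearMap.range (Matrix.toLin' Q)) with hc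
  -- `g ∣ f` ⟹ `det Q = 0` ⟹ `c = 0` in `𝒪`
  intro hgf
  have hQ0 : Q.det = 0 := by
    have hf0 : Ideal.Quotient.mk (Ideal.span {(g : IwasawaAlgebra p)}) f = 0 := by
      rw [Ideal.Quotient.eq_zero_iff_mem, Ideal.mem_span_singleton]; exact hgf
    rw [hf0, Ideal.span_singleton_eq_span_singleton] at hspanQ
    exact associated_zero_iff_eq_zero _ |>.mp hspanQ
  rw [hQ0, zero_mul] at hdet
  have hc0 : (c : IwasawaAlgebra p ⧸ Ideal.span {(g : IwasawaAlgebra p)}) = 0 := by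
    rcases Nat.eq_zero_or_pos n with h0 | hpos
    · rw [h0, pow_zero] at hdet; exact absurd hdet zero_ne_one
    · exact (pow_eq_zero_iff hpos.ne').mp hdet.symm
  -- but `c ≠ 0` in `ℕ`, and `g` divides no non-zero constant
  have hcpos : 0 < c := Nat.card_pos
  have hcO : (c : IwasawaAlgebra p ⧸ Ideal.span {(g : IwasawaAlgebra p)}) =
      Ideal.Quotient.mk (Ideal.span {(g : IwasawaAlgebra p)}) (PowerSeries.C (c : ℤ_[p])) := by
    rw [map_natCast, map_natCast]
  rw [hcO, Ideal.Quotient.eq_zero_iff_mem, Ideal.mem_span_singleton] at hc0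
  have hcZ : (c : ℤ_[p]) ≠ 0 := Nat.cast_ne_zero.mpr hcpos.ne'
  have hfac : (c : ℤ_[p]) = (PadicInt.unitCoeff hcZ : ℤ_[p]) * (p : ℤ_[p]) ^ (c : ℤ_[p]).valuation := PadicInt.unitCoeff_spec hcZ
  rw [hfac, map_mul, map_pow, map_natCast] at hc0
  rcases hgp.dvd_or_dvd hc0 with h1 | h2
  · exact hgp.not_unit (isUnit_of_dvd_unit h1 ((Units.isUnit _).map PowerSeries.C))
  · have h3 : (g : IwasawaAlgebra p) ∣ PowerSeries.C ((p : ℤ_[p]) ^ (c : ℤ_[p]).valuation) := by rw [map_pow, map_natCast]; exact h2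
    exact not_coe_dvd_C_pow hg (one_le_natDegree_of_prime hg hgp) _ h3

end NoFinite

/-! ## §2 The cyclic index splits off its `μ`-part: `#Λ/(F, g) = p^{deg g·μ(F)} · #Λ/(F₀, g)` -/

section Cyclic

/-- ★ **`#Λ/(F, g) = p^{deg g·μ(F)} · #Λ/(F₀, g)`** for EVERY `F ∈ Λ`, `F = p^{μ(F)}·F₀` its `p`-content split (`F₀ = pfree F`), `g` distinguished and
prime in `Λ`: in the domain `𝒪 = Λ/(g)` the order of `𝒪/(ab)` is multiplicative for `a ≠ 0`, and `#Λ/(g, p^k) = p^{k·deg g}`. Hence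
**`p^{deg g·μ(F)} ∣ #Λ/(F, g)`** with no hypothesis on `λ(F)`. [cite: Washington1997, §13.2 (Lemma 13.7, Prop. 13.8) and §13.3] -/
theorem natCard_quotient_span_sup_span_coe_eq_pow_mul (hg : g.IsDistinguishedAt (IsLocalRing.maximalIdeal ℤ_[p])) (hgp : Prime (g : IwasawaAlgebra p))
    (F : IwasawaAlgebra p) :
    Nat.card (IwasawaAlgebra p ⧸ (Ideal.span {F} ⊔ Ideal.span {(g : IwasawaAlgebra p)})) =
      p ^ (g.natDegree * mu F) * Nat.card (IwasawaAlgebra p ⧸ (Ideal.span {pfree F} ⊔ Ideal.span {(g : IwasawaAlgebra p)})) ∧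
    p ^ (g.natDegree * mu F) ∣ Nat.card (IwasawaAlgebra p ⧸ (Ideal.span {F} ⊔ Ideal.span {(g : IwasawaAlgebra p)})) := by
  letI hdom := isDomain_quotient hgp
  have hFfac : F = PowerSeries.C ((p : ℤ_[p]) ^ mu F) * pfree F := eq_C_pow_mu_mul_pfree F
  have hC0 : Ideal.Quotient.mk (Ideal.span {(g : IwasawaAlgebra p)}) (PowerSeries.C ((p : ℤ_[p]) ^ mu F)) ≠ 0 := by
    rw [Ne, Ideal.Quotient.eq_zero_iff_mem, Ideal.mem_span_singleton]
    exact not_coe_dvd_C_pow hg (one_le_natDegree_of_prime hg hgp) (mu F)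
  have hreg : ∀ x : IwasawaAlgebra p ⧸ Ideal.span {(g : IwasawaAlgebra p)},
      (Ideal.Quotient.mk (Ideal.span {(g : IwasawaAlgebra p)}) (PowerSeries.C ((p : ℤ_[p]) ^ mu F))) • x = 0 → x = 0 := fun x hx ↦ by
    rw [smul_eq_mul, mul_eq_zero] at hx
    exact hx.resolve_left hC0
  have hmul := natCard_quotient_span_mul_smul_top (M := IwasawaAlgebra p ⧸ Ideal.span {(g : IwasawaAlgebra p)})
    (Ideal.Quotient.mk (Ideal.span {(g : IwasawaAlgebra p)}) (PowerSeries.C ((p : ℤ_[p]) ^ mu F)))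
    (Ideal.Quotient.mk (Ideal.span {(g : IwasawaAlgebra p)}) (pfree F)) hreg
  simp only [Ideal.smul_eq_mul, Ideal.mul_top] at hmul
  rw [← map_mul, ← hFfac, natCard_quotient_span_mk_eq_natCard_quotient_sup, natCard_quotient_span_mk_eq_natCard_quotient_sup,
    natCard_quotient_span_mk_eq_natCard_quotient_sup, sup_comm (Ideal.span {PowerSeries.C ((p : ℤ_[p]) ^ mu F)}),
    natCard_quotient_span_coe_sup_span_C_pow hg, mul_comm (mu F)] at hmul
  exact ⟨hmul, Dvd.intro _ hmul.symm⟩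

end Cyclic

/-! ## §3 ANY finitely generated torsion `X`: `p^{deg g·μ(f)} ∣ #(X/gX)` unconditionally; `0 < #(X/gX) < p^{deg g} ⟹ μ = 0` -/

section General

/-- ★★ **`g ∣ f ⟹ X/gX` IS INFINITE** (`Nat.card = 0`) for every f.g. torsion `X` with `char_Λ X = (f)`: the quotient `X' = X/F` by the largest finite submodule has
`char X' = (f)` and `#(X'/gX') ∣ #(X/gX)` (a surjection), while `X'/gX'` finite would force `g ∤ f` (§1). [cite: Washington1997, §13.3] [cite: NeukirchSchmidtWingberg2008, (5.3.1)] -/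
theorem natCard_quotient_smul_top_eq_zero_of_dvd (hg : g.IsDistinguishedAt (IsLocalRing.maximalIdeal ℤ_[p])) (hgp : Prime (g : IwasawaAlgebra p))
    [Module.Finite (IwasawaAlgebra p) M] (hM : Module.IsTorsion (IwasawaAlgebra p) M) {f : IwasawaAlgebra p}
    (hchar : Literature.NumberTheory.EllipticCurves.Module.charIdeal (IwasawaAlgebra p) M = Ideal.span {f}) (hgf : (g : IwasawaAlgebra p) ∣ f) :
    Nat.card (M ⧸ (Ideal.span {(g : IwasawaAlgebra p)} • ⊤ : Submodule (IwasawaAlgebra p) M)) = 0 := by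
  haveI : IsNoetherian (IwasawaAlgebra p) M := inferInstance
  obtain ⟨F, hFfin, hFmax⟩ := exists_finite_submodule_forall_finite_le (R := IwasawaAlgebra p) (M := M)
  haveI : Finite F := hFfin
  have hF := forall_finite_eq_bot_quotient_of_forall_finite_le F hFmax
  obtain ⟨hM', hchar'⟩ := isTorsion_and_charIdeal_quotient_eq hM F
  rw [hchar] at hchar'
  by_contra hne
  have hdvd := natCard_quotient_quotient_smul_top_dvd F (g : IwasawaAlgebra p) (M := M)
  have hne' : Nat.card ((M ⧸ F) ⧸ (Ideal.span {(g : IwasawaAlgebra p)} • ⊤ : Submodule (IwasawaAlgebra p) (M ⧸ F))) ≠ 0 := by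
    intro h0
    rw [h0, zero_dvd_iff] at hdvd
    exact hne hdvd
  exact not_dvd_of_natCard_quotient_smul_top_ne_zero hg hgp hM' hF hchar' hne' hgf

/-- ★★ **`g ∤ f ⟹ #(X/gX) = #Λ/(f, g) · #(F/gF)`** (`X` ANY f.g. torsion, `char_Λ X = (f)`, `F ≤ X` finite with `X/F` free of finite submodules): §1 for `X/F`
and `0 → F/gF → X/gX → (X/F)/g(X/F) → 0` (`g` is `X/F`-regular). [cite: Washington1997, §13.3 (Thm. 13.13)] [cite: Fulton1998, Lemma A.2.6] -/
theorem natCard_quotient_smul_top_eq_mul_of_not_dvd (hg0 : PowerSeries.constantCoeff (g : IwasawaAlgebra p) = p) (hgp : Prime (g : IwasawaAlgebra p))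
    [Module.Finite (IwasawaAlgebra p) M] (hM : Module.IsTorsion (IwasawaAlgebra p) M) (F : Submodule (IwasawaAlgebra p) M) [Finite F]
    (hF : ∀ N : Submodule (IwasawaAlgebra p) (M ⧸ F), Finite N → N = ⊥) {f : IwasawaAlgebra p}
    (hchar : Literature.NumberTheory.EllipticCurves.Module.charIdeal (IwasawaAlgebra p) M = Ideal.span {f}) (hgf : ¬ (g : IwasawaAlgebra p) ∣ f) :
    Nat.card (M ⧸ (Ideal.span {(g : IwasawaAlgebra p)} • ⊤ : Submodule (IwasawaAlgebra p) M)) =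
      Nat.card (IwasawaAlgebra p ⧸ (Ideal.span {f} ⊔ Ideal.span {(g : IwasawaAlgebra p)})) *
        Nat.card (F ⧸ (Ideal.span {(g : IwasawaAlgebra p)} • ⊤ : Submodule (IwasawaAlgebra p) F)) := by
  obtain ⟨hM', hchar'⟩ := isTorsion_and_charIdeal_quotient_eq hM F
  rw [hchar] at hchar'
  have hkill : ∀ x : M ⧸ F, f • x = 0 := smul_eq_zero_of_charIdeal_eq_span_of_noFiniteSubmodule p (M ⧸ F) hM' hF hchar'
  have hreg : ∀ x : M ⧸ F, (g : IwasawaAlgebra p) • x = 0 → x = 0 := coe_smul_eq_zero_imp hF hkill hg0 hgp hgf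
  rw [natCard_quotient_smul_top_eq_mul_of_quotient_regular F (g : IwasawaAlgebra p) hreg,
    natCard_quotient_smul_top_eq_natCard_quotient_span_sup hg0 hgp hM' hF hchar' hgf]

/-- ★★★ **`p^{deg g·μ(f)} ∣ #(X/gX)` UNCONDITIONALLY**: `X` ANY finitely generated torsion `Λ`-module, `char_Λ X = (f)`, `g` ANY Eisenstein distinguished polynomial
(`g(0) = p`, prime in `Λ`); `Nat.card` (if `g ∣ f` the quotient is infinite and the statement reads `∣ 0`). [cite: Washington1997, §13.3 (Thm. 13.13)]
[cite: NeukirchSchmidtWingberg2008, (5.3.17)] -/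
theorem pow_dvd_natCard_quotient_smul_top' (hg : g.IsDistinguishedAt (IsLocalRing.maximalIdeal ℤ_[p]))
    (hg0 : PowerSeries.constantCoeff (g : IwasawaAlgebra p) = p) (hgp : Prime (g : IwasawaAlgebra p)) [Module.Finite (IwasawaAlgebra p) M]
    (hM : Module.IsTorsion (IwasawaAlgebra p) M) {f : IwasawaAlgebra p}
    (hchar : Literature.NumberTheory.EllipticCurves.Module.charIdeal (IwasawaAlgebra p) M = Ideal.span {f}) :
    p ^ (g.natDegree * mu f) ∣ Nat.card (M ⧸ (Ideal.span {(g : IwasawaAlgebra p)} • ⊤ : Submodule (IwasawaAlgebra p) M)) := by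
  by_cases hgf : (g : IwasawaAlgebra p) ∣ f
  · rw [natCard_quotient_smul_top_eq_zero_of_dvd hg hgp hM hchar hgf]; exact dvd_zero _
  haveI : IsNoetherian (IwasawaAlgebra p) M := inferInstance
  obtain ⟨F, hFfin, hFmax⟩ := exists_finite_submodule_forall_finite_le (R := IwasawaAlgebra p) (M := M)
  haveI : Finite F := hFfin
  rw [natCard_quotient_smul_top_eq_mul_of_not_dvd hg0 hgp hM F (forall_finite_eq_bot_quotient_of_forall_finite_le F hFmax) hchar hgf]
  exact ((natCard_quotient_span_sup_span_coe_eq_pow_mul hg hgp f).2).mul_right _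

/-- ★★★ **HYPOTHESIS-FREE `μ = 0` CERTIFICATE: `0 < #(X/gX) < p^{deg g} ⟹ μ(f) = 0`** for EVERY finitely generated torsion `Λ`-module `X` with `char_Λ X = (f)`
and EVERY Eisenstein distinguished `g` — no `λ`-bookkeeping, no finite-submodule hypothesis, no exact count. [cite: Washington1997, §13.3 (Thm. 13.13)]
[cite: GreenbergLNM1716, Conj. 1.11] -/
theorem mu_eq_zero_of_natCard_quotient_smul_top_pos_lt (hg : g.IsDistinguishedAt (IsLocalRing.maximalIdeal ℤ_[p]))
    (hg0 : PowerSeries.constantCoeff (g : IwasawaAlgebra p) = p) (hgp : Prime (g : IwasawaAlgebra p)) [Module.Finite (IwasawaAlgebra p) M]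
    (hM : Module.IsTorsion (IwasawaAlgebra p) M) {f : IwasawaAlgebra p}
    (hchar : Literature.NumberTheory.EllipticCurves.Module.charIdeal (IwasawaAlgebra p) M = Ideal.span {f})
    (hpos : 0 < Nat.card (M ⧸ (Ideal.span {(g : IwasawaAlgebra p)} • ⊤ : Submodule (IwasawaAlgebra p) M)))
    (hlt : Nat.card (M ⧸ (Ideal.span {(g : IwasawaAlgebra p)} • ⊤ : Submodule (IwasawaAlgebra p) M)) < p ^ g.natDegree) : mu f = 0 := by
  have hle := (Nat.le_of_dvd hpos (pow_dvd_natCard_quotient_smul_top' hg hg0 hgp hM hchar)).trans_lt hlt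
  have hexp := (Nat.pow_lt_pow_iff_right hp.out.one_lt).mp hle
  by_contra hμ
  have h1 : 1 ≤ mu f := Nat.one_le_iff_ne_zero.mpr hμ
  have : g.natDegree ≤ g.natDegree * mu f := Nat.le_mul_of_pos_right _ h1
  omega

/-- ★★★ **GREENBERG'S `μ = 0` FROM ONE LAYER QUOTIENT, AT ANY ONE LAYER: `0 < #(X/Ψ_n X) < p^{pⁿ(p−1)} ⟹ μ(f) = 0`** (`X` ANY f.g. torsion `Λ`-module,
`char_Λ X = (f)`, `Ψ_n = Φ_{p^{n+1}}(1+T)`, ANY `n`). [cite: Washington1997, §13.3 (Thm. 13.13)] [cite: GreenbergLNM1716, Conj. 1.11 and p. 180] -/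
theorem mu_eq_zero_of_natCard_layerQuotient_pos_lt [Module.Finite (IwasawaAlgebra p) M] (hM : Module.IsTorsion (IwasawaAlgebra p) M)
    {f : IwasawaAlgebra p} (hchar : Literature.NumberTheory.EllipticCurves.Module.charIdeal (IwasawaAlgebra p) M = Ideal.span {f}) {n : ℕ}
    (hpos : 0 < Nat.card (M ⧸ (Ideal.span {(((Polynomial.cyclotomic (p ^ (n + 1)) ℤ_[p]).comp (Polynomial.X + 1) : ℤ_[p][X]) : IwasawaAlgebra p)} • ⊤ :
      Submodule (IwasawaAlgebra p) M)))
    (hlt : Nat.card (M ⧸ (Ideal.span {(((Polynomial.cyclotomic (p ^ (n + 1)) ℤ_[p]).comp (Polynomial.X + 1) : ℤ_[p][X]) : IwasawaAlgebra p)} • ⊤ :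
      Submodule (IwasawaAlgebra p) M)) < p ^ (p ^ n * (p - 1))) : mu f = 0 := by
  rw [← natDegree_cyclotomicLayer p n] at hlt
  exact mu_eq_zero_of_natCard_quotient_smul_top_pos_lt (cyclotomic_comp_isDistinguishedAt_maximalIdeal p n) (constantCoeff_cyclotomicLayer p n)
    (prime_coe_cyclotomic_comp p n) hM hchar hpos hlt

/-- ★★★ **`μ(X) = 0` FROM ONE LAYER QUOTIENT** — the module form, characteristic generator hidden: for EVERY finitely generated torsion `Λ`-module `X` and
ANY `n`, **`0 < #(X/Ψ_n X) < p^{pⁿ(p−1)} ⟹ μ(X) = 0`** (`char_Λ X` is principal with a non-zero generator; `μ(X) = μ(generator)`).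
[cite: Washington1997, §13.2–13.3] [cite: GreenbergLNM1716, Conj. 1.11] -/
theorem muInvariant_eq_zero_of_natCard_layerQuotient_pos_lt [Module.Finite (IwasawaAlgebra p) M] (hM : Module.IsTorsion (IwasawaAlgebra p) M) {n : ℕ}
    (hpos : 0 < Nat.card (M ⧸ (Ideal.span {(((Polynomial.cyclotomic (p ^ (n + 1)) ℤ_[p]).comp (Polynomial.X + 1) : ℤ_[p][X]) : IwasawaAlgebra p)} • ⊤ :
      Submodule (IwasawaAlgebra p) M)))
    (hlt : Nat.card (M ⧸ (Ideal.span {(((Polynomial.cyclotomic (p ^ (n + 1)) ℤ_[p]).comp (Polynomial.X + 1) : ℤ_[p][X]) : IwasawaAlgebra p)} • ⊤ :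
      Submodule (IwasawaAlgebra p) M)) < p ^ (p ^ n * (p - 1))) : muInvariant p M = 0 := by
  obtain ⟨f, hf0, hchar⟩ := exists_charGenerator_ne_zero M hM
  rw [← Summit.BirchSwinnertonDyer.Rank1Residual.X1.MuPart.mu_generator_eq_muInvariant M hM hf0 hchar]
  exact mu_eq_zero_of_natCard_layerQuotient_pos_lt hM hchar hpos hlt

end General

end Summit.BirchSwinnertonDyer.BirchSwinnertonDyer.Theorems.AlignedTransportAtTwoHalfDescentLayerIndexCertificate

end
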